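import Summits.NavierStokesRegularity.NavierStokesRegularity.Theses.TautLoopKelvin
import Summits.NavierStokesRegularity.NavierStokesRegularity.Theses.TypeILiouville
import Summits.NavierStokesRegularity.NavierStokesRegularity.Theses.TypeICertificateLadder
import Summits.NavierStokesRegularity.NavierStokesRegularity.Theorems.TautLoopKelvinTautCompressionIntegrableStubExtension
import Summits.NavierStokesRegularity.NavierStokesRegularity.Theorems.CirculationFloor.Negative.ClayVacuity
import HarnessLib

/-!
# `TautLoopKelvin.TautCompressionIntegrable` (stmt-NavierStokesRegularity-15248) is summit-equivalent:
  the kernel-checked certificate, BY ITEM NAME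

The crux K1 (`TautCompressionIntegrable`: for every classical solution of unforced Navier–Stokes on
`ℝ³ × [0,T)` that is Leray–Hopf on `[0,T]` from a rapidly decaying datum and every level `g > 0`, the
near-taut compression rate `Λ_g` has a measurable majorant on `(0,T)` with finite integral of its positive
part) sits between two EXISTING items of the ledger, with nothing in between:

* `tautCompressionIntegrable_of_typeILiouvilleThesis` — **K1 follows from the no-blow-up item
  `TypeILiouville.TypeIliouvilleThesis` (stmt-NavierStokesRegularity-0054)** verbatim: that item is literally
  the hypothesis of the landed `Birth.tautCompressionIntegrable_of_noBlowup` (every solution of the class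
  extends classically past `T`, and an extending solution has bounded velocity gradient on `[0,T) × ℝ³`, which
  bounds `Λ_g`).
* `tautCompressionIntegrable_of_noTypeIBlowup_of_noTypeII` — the same from the two rate-split items
  `TypeICertificateLadder.NoTypeIBlowup` (stmt-1217) and `TypeICertificateLadder.NoTypeII` (stmt-0056), whose
  conjunction is stmt-0054 (excluded middle on the Type-I rate at a non-extending time).
* `typeILiouvilleThesis_of_navierStokesRegularity` — stmt-0054 follows from the summit `NavierStokesRegularity`
  (Clay (A)); the tree's blow-up assembly with the proved Clay-class uniqueness, packaged in the landed
  `CirculationFloor.Negative.circulationFloor_hypotheses_iff_not_navierStokesRegularity`.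
* `typeILiouvilleThesis_of_tautCompressionIntegrable` — conversely **K1 together with the route's two other
  cruxes `TautLoopLaw` (stmt-15249) and `CirculationFloor` (stmt-1538) gives stmt-0054**: the route's deciding
  theorem `TautLoopKelvin.closes` followed by the previous item.
* `tautCompressionIntegrable_iff_typeILiouvilleThesis`, `tautCompressionIntegrable_iff_navierStokesRegularity` —
  hence, GIVEN `TautLoopLaw ∧ CirculationFloor`, K1 is equivalent to stmt-0054 and to the summit itself.

Consequence for the crux chain of stmt-15248 (recorded in the crux's `Lines/*.dead.md` and `PICKED.md`): every
line for K1 must contain a stub proving no blow-up for the whole hypothesis class (or a regime of it: the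
Type-I half is stmt-1217, the rest is stmt-0056); K1 is a necessary condition for regularity asserted
unconditionally (a length-valued Beale–Kato–Majda criterion), and the item is parked on stmt-0054.
No statement of any route is asserted here; all theorems are implications between named items.
-/

noncomputable section

namespace Summit.NavierStokesRegularity.NavierStokesRegularity.Theorems.TautCompressionIntegrable.SummitEquivalence

open Summit.NavierStokesRegularity.NavierStokesRegularity
open Literature.Analysis.FluidPDE

set_option linter.dupNamespace false

/-- **K1 from the no-blow-up item stmt-NavierStokesRegularity-0054.** If every classical solution of unforced
Navier–Stokes on `ℝ³ × [0,T)` which is Leray–Hopf on `[0,T]` from a rapidly decaying datum extends classically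
past `T` (`TypeILiouville.TypeIliouvilleThesis`), then `TautLoopKelvin.TautCompressionIntegrable` holds: the
item is verbatim the hypothesis of the landed `Birth.tautCompressionIntegrable_of_noBlowup`. [folklore] -/
theorem tautCompressionIntegrable_of_typeILiouvilleThesis
    (hNB : Theses.TypeILiouville.TypeIliouvilleThesis) :
    Theses.TautLoopKelvin.TautCompressionIntegrable :=
  Theorems.TautCompressionIntegrable.Birth.tautCompressionIntegrable_of_noBlowup hNB

/-- **K1 from the rate-split items stmt-1217 and stmt-0056.** `NoTypeIBlowup` (a solution of the class with
the Type-I rate at `T` extends past `T`) and `NoTypeII` (a maximal solution of the class has the Type-I rate at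
its final time) together continue every solution of the class past every `T > 0`, which is stmt-0054, whence
K1 by `tautCompressionIntegrable_of_typeILiouvilleThesis`. [folklore] -/
theorem tautCompressionIntegrable_of_noTypeIBlowup_of_noTypeII
    (hI : Theses.TypeICertificateLadder.NoTypeIBlowup) (hII : Theses.TypeICertificateLadder.NoTypeII) :
    Theses.TautLoopKelvin.TautCompressionIntegrable := by
  refine tautCompressionIntegrable_of_typeILiouvilleThesis ?_
  intro ν T hν hT u p hcl hLH hdec
  by_contra hext
  exact hext (hI ν T hν hT u p hcl hLH hdec (hII ν T hν hT u p ⟨hcl, hext⟩ hLH hdec))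

/-- **stmt-0054 from the summit.** Clay (A) (`NavierStokesRegularity`) excludes blow-up in the class: a
non-extending classical Leray–Hopf solution from a rapidly decaying datum would inhabit the hypothesis class
of `CirculationFloor`, which is inhabited iff `¬ NavierStokesRegularity`
(`CirculationFloor.Negative.circulationFloor_hypotheses_iff_not_navierStokesRegularity`: the tree's blow-up
assembly with the proved uniqueness of Clay-class solutions). [folklore] -/
theorem typeILiouvilleThesis_of_navierStokesRegularity (hA : _root_.NavierStokesRegularity) :
    Theses.TypeILiouville.TypeIliouvilleThesis := by
  intro ν T hν hT u p hcl hLH hdec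
  by_contra hext
  exact Theorems.CirculationFloor.Negative.circulationFloor_hypotheses_iff_not_navierStokesRegularity.1
    ⟨ν, T, u, p, hν, hT, hcl, hLH, hdec, hext⟩ hA

/-- **K1 with the route's two other cruxes gives stmt-0054.** `TautCompressionIntegrable`, `TautLoopLaw`
(stmt-15249) and `CirculationFloor` (stmt-1538) prove the summit by the route's deciding theorem
`TautLoopKelvin.closes`, hence no blow-up in the class (`typeILiouvilleThesis_of_navierStokesRegularity`).
[folklore] -/
theorem typeILiouvilleThesis_of_tautCompressionIntegrable
    (hK1 : Theses.TautLoopKelvin.TautCompressionIntegrable) (hLaw : Theses.TautLoopKelvin.TautLoopLaw)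
    (hFloor : Theses.TautLoopKelvin.CirculationFloor) :
    Theses.TypeILiouville.TypeIliouvilleThesis :=
  typeILiouvilleThesis_of_navierStokesRegularity (Theses.TautLoopKelvin.closes hK1 hLaw hFloor)

/-- **Given `TautLoopLaw ∧ CirculationFloor`, K1 is equivalent to the no-blow-up item stmt-0054.**
[folklore] -/
theorem tautCompressionIntegrable_iff_typeILiouvilleThesis
    (hLaw : Theses.TautLoopKelvin.TautLoopLaw) (hFloor : Theses.TautLoopKelvin.CirculationFloor) :
    Theses.TautLoopKelvin.TautCompressionIntegrable ↔ Theses.TypeILiouville.TypeIliouvilleThesis :=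
  ⟨fun hK1 => typeILiouvilleThesis_of_tautCompressionIntegrable hK1 hLaw hFloor,
    tautCompressionIntegrable_of_typeILiouvilleThesis⟩

/-- **Given `TautLoopLaw ∧ CirculationFloor`, K1 is equivalent to the summit `NavierStokesRegularity`.**
[folklore] -/
theorem tautCompressionIntegrable_iff_navierStokesRegularity
    (hLaw : Theses.TautLoopKelvin.TautLoopLaw) (hFloor : Theses.TautLoopKelvin.CirculationFloor) :
    Theses.TautLoopKelvin.TautCompressionIntegrable ↔ _root_.NavierStokesRegularity :=
  ⟨fun hK1 => Theses.TautLoopKelvin.closes hK1 hLaw hFloor,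
    fun hA => tautCompressionIntegrable_of_typeILiouvilleThesis
      (typeILiouvilleThesis_of_navierStokesRegularity hA)⟩

/-- **Registered tools stub `stub_summitEquivalenceTools` of the crux stmt-NavierStokesRegularity-15248**
(`ledger workitem stub-add`, line lead c1): the four implications of this file as one conjunction —
stmt-0054 ⇒ K1; stmt-1217 ∧ stmt-0056 ⇒ K1; summit ⇒ stmt-0054; K1 ∧ stmt-15249 ∧ stmt-1538 ⇒ stmt-0054.
[folklore] -/
theorem stub_summitEquivalenceTools :
    (Summit.NavierStokesRegularity.NavierStokesRegularity.Theses.TypeILiouville.TypeIliouvilleThesis →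
      Summit.NavierStokesRegularity.NavierStokesRegularity.Theses.TautLoopKelvin.TautCompressionIntegrable) ∧
    (Summit.NavierStokesRegularity.NavierStokesRegularity.Theses.TypeICertificateLadder.NoTypeIBlowup →
      Summit.NavierStokesRegularity.NavierStokesRegularity.Theses.TypeICertificateLadder.NoTypeII →
      Summit.NavierStokesRegularity.NavierStokesRegularity.Theses.TautLoopKelvin.TautCompressionIntegrable) ∧
    (NavierStokesRegularity →
      Summit.NavierStokesRegularity.NavierStokesRegularity.Theses.TypeILiouville.TypeIliouvilleThesis) ∧
    (Summit.NavierStokesRegularity.NavierStokesRegularity.Theses.TautLoopKelvin.TautCompressionIntegrable →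
      Summit.NavierStokesRegularity.NavierStokesRegularity.Theses.TautLoopKelvin.TautLoopLaw →
      Summit.NavierStokesRegularity.NavierStokesRegularity.Theses.TautLoopKelvin.CirculationFloor →
      Summit.NavierStokesRegularity.NavierStokesRegularity.Theses.TypeILiouville.TypeIliouvilleThesis) :=
  ⟨tautCompressionIntegrable_of_typeILiouvilleThesis, tautCompressionIntegrable_of_noTypeIBlowup_of_noTypeII,
    typeILiouvilleThesis_of_navierStokesRegularity, typeILiouvilleThesis_of_tautCompressionIntegrable⟩

end Summit.NavierStokesRegularity.NavierStokesRegularity.Theorems.TautCompressionIntegrable.SummitEquivalence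

end
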